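import Summits.QuantumFields.BalabanUV.Beta.GAN24.DerivativeRateTransferKKTSources
import Summits.QuantumFields.BalabanUV.Beta.GAN24.DerivativeRateTransferAnalyticKKTCurve

/-!
# `BalabanUV.Beta.GAN24.DerivativeRateTransferKKTSourcesEnd` — binder row G-an2-4 ∕ (CONV-C), route R6 «VALUES, NOT DERIVATIVES», PART 43:
# THE TOWER END OF «KKT POINTS WITH SOURCES» — (CONS♭)(j) `⟨ℋ̃_{j,1}e, D_j ℋ̃_{j,1}e⟩ ≤ 2(C_G·c_F + c_S·c_U)·θ^j·⟨e,e⟩` for every level `j` from the k-uniform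
# rows (FLUC-OP) + (SRC) + the form-level (CONS) value row + (STAB) (and its H-SIDE twin with the kernel row `D_j ≤ c_D·H_j on ker Qc_j`), with the identifications `𝒮(Λ_j, Qc_j) = 𝒮_{j+1}`, `ℋ(Λ_j, Qc_j) = Qf_j·ℋ_{j+1} = ℋ̃_j`
# (an2's composition law at `G = 0`), `D_j = Λ_j − H_j ⪰ 0 ⟸ (STAB)`, and the jet direction of the true tower NAMED: `ℋ̃_{j,1} = dℋ(Λ_j, Qc_j; Λ_{j,1}, Qc_{j,1})`,
# `Λ_{j,1} = d𝒮(H_{j+1}, Qf_j; H_{j+1,1}, Qf_{j,1})` along any differentiable curve of data (PART 14 BY NAME) (unit b2b-balaban-gan24-p3, gen 40; v1.5 = v1 + the H-side rows §2∕§3 + the kernel row from a prolongation row §2 + `isUnit_det_kkt_oneStep` §1 + the second-order one-level row §2 + the Schur-test currency junction §2)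

NOT IN PRINT; OUR PROOF (for the ROUTE; [folklore] finite-dimensional linear algebra — PART 42 `DerivativeRateTransferKKTSources.jet_constrained_energy_le_of_rows`, an2's
`Beta.CompositionSingular.{effForm_compForm, minOp_compForm, mul_minOp, minOpL_eq_transpose}` + `B9SectECov.compForm_zero`, PART 18
`DerivativeRateTransferLoewnerKKT.{dotProduct_effForm_eq_energy, mulVec_minOp, dotProduct_effForm_le_trial, transpose_eq_of_posSemidef, mulVec_dotProduct_eq}`, PART 14
`DerivativeRateTransferAnalyticKKTCurve.{hasDerivAt_effForm_curve, hasDerivAt_minOp_curve}` BY NAME).  CREDIT: the reduction «(CONS♭) ⟸ mixed Gram identity + (FLUC-OP) + (SRC)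
+ the (CONS) value row + (STAB)» is gan24-idea-1 g49's LENS ITEM 6 (ROUTES-GAN24 v49 R6 NOTE (a)(b)(e)); PRICING-GAN24 v3.42 (Q-49-3) accepted it as the reduction SHAPE;
this file is its kernel form along the tower.  HONEST FRAMING (cell contract, verbatim): «discharging `BetaPertH` makes Bałaban's UV stability UNCONDITIONAL — a real
constructive-QFT result; it is NOT the continuum limit and NOT the Clay problem.»  HONEST DEPENDENCY (verbatim): «continuum YM on T⁴ ⇐ BetaPertH ∧ nine spine estimates
(0/9 proved); BetaPertH ⇐ (D1) ∧ (D4) ∧ CAP+tail; G-an2-4 gates asym, D1 and NE2/3/4.»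

THE TOWER LETTERS (PART 18 §4 ∕ PART 41): fine lattices `ι j`, unit lattice `c`, PSD fine forms `H j` (singular allowed), one-step averagings `Qf j : ι (j+1) → ι j`,
composite averagings `Qc j : ι j → c` with `Qc (j+1) = Qc j · Qf j`; `𝒮_j := 𝒮(H j, Qc j)`, `ℋ_j := ℋ(H j, Qc j)`; the ONE-STEP EFFECTIVE FORM `Λ_j := 𝒮(H (j+1), Qf j)` on
`ι j` and the one-step form defect `D_j := Λ_j − H_j` (PART 41: `𝒮_{j+1} − 𝒮_j = ℋ_jᵀ·D_j·ℋ̃_j`); `ℋ̃_j := ℋ(Λ_j, Qc_j) = Qf_j·ℋ_{j+1}`.  The JET LETTERS: a direction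
`(Λ₁ j, Q₁ j)` of the data `(Λ_j, Qc_j)` (for a true tower: `Λ₁ j = d𝒮(H_{j+1}, Qf_j; H_{j+1,1}, Qf_{j,1})`, `Q₁ j = Qc_{j,1}`, §4), `ℋ̃_{j,1} := dℋ(Λ_j, Qc_j; Λ₁ j, Q₁ j)`
with SOURCES `f_{j,1} := ((Q₁ j)ᵀ𝒮_{j+1} − Λ₁ j·ℋ̃_j)` and `u_{j,1} := Q₁ j·ℋ̃_j` (PART 42 (J)).

WHAT THIS FILE PROVES (0 sorry, 0 `def`, nothing cited):
* §1 (any field) `effForm_oneStep_comp` (`𝒮(𝒮(H′,q), Q) = 𝒮(H′, Q·q)`), `minOp_oneStep_comp` (`ℋ(𝒮(H′,q), Q) = q·ℋ(H′, Q·q)`) — an2's composition law at `G = 0`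
  (PART 41's `tE ∕ tM` as named theorems) — and `isUnit_det_kkt_oneStep` (`kkt H′ q`, `kkt H′ (Q·q)` nonsingular ⟹ `kkt 𝒮(H′,q) Q` nonsingular; an2's
  `det_kkt_compForm_ne_zero_iff` at `G = 0`), so the ENDs carry no separate hypothesis on `kkt Λ_j (Qc j)`.
* §2 (`ℝ`) **`oneStep_defect_posSemidef_of_stab`** (`(STAB) H′ ≥ qᵀHq`, `H′ ⪰ 0`, `H` symmetric ⟹ `𝒮(H′,q) − H ⪰ 0` — «`D₀ ⪰ 0 ⟺ (STAB)`», v48 NOTE (b), in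
  bordered letters with singular fine forms), **`oneStep_defect_form_le_of_prol`** (the KERNEL row: `q·P = 1` + `PᵀH′P ≤ (1 + ε)H + δG` ⟹ `𝒮(H′,q) − H ≤ εH + δG`
  as forms — `c_D = ε`; flat model class `ε = L − 1`, `δ = 0`), **`dotProduct_effForm_step_le_cons`** (PART 18's diagonal (CONS) step POLARISED: `⟨v,(𝒮′ − 𝒮)v⟩ ≤ ⟨ℋv,(PᵀH′P − H)ℋv⟩`
  for every `v`, so a form-level (CONS) IS the value row of PART 42 §5), `effForm_step_form_le_of_cons`, the CURRENCY JUNCTION **`form_le_of_abs_rowSum_le`** (Schur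
  test: symmetric `M` with absolute row sums `≤ R` ⟹ `⟨x,Mx⟩ ≤ R⟨x,x⟩` — C-R6°'s entrywise-with-decay value rate ⟹ the form-currency value row), and the H-SIDE jet at one level
  **`jet_constrained_energy_H_le_of_rows`** (`⟨dℋ(H,Q;H₁,Q₁)e,(Λ − H)dℋ(H,Q;H₁,Q₁)e⟩ ≤ 4(1 + c_D)(C_G·F + C_S·U)` with the KERNEL row `Λ − H ≤ c_D·H on ker Q`;
  PART 42 `constrained_energy_H_le` + `pairing_sub_le_two_rows`), and the SECOND-ORDER row at one level **`jet₂_constrained_energy_le_of_rows`** (the `t²`-coefficient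
  `(jet₂)₁₂ e + dℋ(Λ,Q;Λ₂,Q₂)e` of the minimiser along `t ↦ (Λ + tΛ₁ + t²Λ₂, Q + tQ₁ + t²Q₂)` is a KKT point with sources `f₂, u₂` — PART 42 (J) — hence
  `≤ 2(C_G·F₂ + C_S·U₂)`; leg T002 of PART 41's second-order split).
* §3 (`ℝ`) **`jetRange_cons_rate_of_rows` — THE END**: `H j ⪰ 0`, nonsingular `kkt (H j) (Qc j)` and `kkt (H (j+1)) (Qf j)`, `Qc (j+1) = Qc j · Qf j`, (STAB_j), k-uniform (FLUC-OP)
  `⟨x, (𝒢(H_j,Qc_j) − 𝒢(Λ_j,Qc_j))x⟩ ≤ C_G⟨x,x⟩`, the (CONS) value row `⟨y, (𝒮_{j+1} − 𝒮_j)y⟩ ≤ c_S·θ^j·⟨y,y⟩`, (SRC) `⟨f_{j,1}e, f_{j,1}e⟩ ≤ c_F·θ^j·⟨e,e⟩`,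
  `⟨u_{j,1}e, u_{j,1}e⟩ ≤ c_U·⟨e,e⟩` ⟹ **`⟨ℋ̃_{j,1}e, D_j ℋ̃_{j,1}e⟩ ≤ 2(C_G·c_F + c_S·c_U)·θ^j·⟨e,e⟩` for all `j, e`**; and `jetRange_cons_rate_of_cons` (the value row
  replaced by a form-level (CONS) `⟨ℋ_j v,(P_jᵀH_{j+1}P_j − H_j)ℋ_j v⟩ ≤ c_S·θ^j·⟨v,v⟩` with `Qc (j+1)·P j = Qc j`); and the H-SIDE row **`jetRange_cons_rate_H_of_rows`**
  (`ℋ_{j,1} := dℋ(H_j,Qc_j;H₁ j,Q₁ j)`: `⟨ℋ_{j,1}e,(Λ_j − H_j)ℋ_{j,1}e⟩ ≤ 4(1 + c_D)(C_G·c_F + c_S·c_U)·θ^j·⟨e,e⟩` with the k-uniform KERNEL row `Λ_j − H_j ≤ c_D·H_j on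
  ker Qc_j` — leg I of PART 41's first-order split; §3's first row is leg III).
* §4 (`ℝ`, PART 14 BY NAME) **`hasDerivAt_decimated_minOp_curve`** — along any entrywise-differentiable curve of data `s ↦ (H₊(s), q(s), Q(s))` the decimated minimiser
  `s ↦ ℋ(𝒮(H₊(s), q(s)), Q(s))` has derivative `dℋ(Λ, Q; d𝒮(H₊,q;H₊′,q′), Q′)`: the jet direction `(Λ₁, Q₁)` of §3 for the true tower IS `(d𝒮(H_{j+1},Qf_j;·,·), Qc_{j,1})`.
WHAT IT DOES NOT DO: supply C_G (FLUC-OP), c_F ∕ c_U (SRC), c_S ((CONS) ∕ C-R6°'s value rate) or (STAB) for any of Bałaban's operators — OPEN support rows (PRICING-GAN24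
v3.42 Q-49-1∕2; toy t49: C_G .14–.19, ‖f₁‖² flat, u₁ O(1), c_D = L − 1 (L = 2), gan24-idea-1's numbers, not theorems), nor c_D; the second-order row is given at one level only (its
tower form needs second-order (SRC) letters `f_{j,2}, u_{j,2}`, displayed in §2's docstring, not iterated here).  SUPPLIER work on route R6 (rank 2, REDUCTION, no seat); no consumer of record; NEVER «G-an2-4 closed»; NOT (CONV-C),
NOT D1, NOT `BetaPertH`, NOT continuum, NOT Clay.  Records: `HOME/b2b-balaban-gan24-p3/WOODBURY-FIBRE.md` v14.0.
-/

noncomputable section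

open Matrix

namespace Summit.QuantumFields.BalabanUV.Beta.GAN24.DerivativeRateTransferKKTSourcesEnd

open Literature.MathematicalPhysics.QuantumFieldTheory.Balaban1983to89.Beta.Composition (kkt compForm)
open Literature.MathematicalPhysics.QuantumFieldTheory.Balaban1983to89.Beta.CompositionSingular (effForm minOp flucCov mul_minOp effForm_compForm
  minOp_compForm minOpL_eq_transpose det_kkt_compForm_ne_zero_iff)
open Literature.MathematicalPhysics.QuantumFieldTheory.Balaban1983to89.B9SectECov (compForm_zero)
open Literature.MathematicalPhysics.QuantumFieldTheory.Balaban1983to89.Beta.BorderedJets (dMinOp dEffForm jet₂)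
open Summit.QuantumFields.BalabanUV.Beta.GAN24.DerivativeRateTransferLoewnerKKT (transpose_eq_of_posSemidef mulVec_dotProduct_eq dotProduct_effForm_eq_energy
  mulVec_minOp dotProduct_effForm_le_trial)
open Summit.QuantumFields.BalabanUV.Beta.GAN24.DerivativeRateTransferKKTSources (jet_constrained_energy_le_of_rows constrained_energy_H_le
  pairing_sub_le_two_rows dMinOp_mulVec_eq_kktPoint dMinOp_eq_kktPoint jet₂_minOp_eq_kktPoint constrained_energy_le_of_rows)
open Summit.QuantumFields.BalabanUV.Beta.GAN24.DerivativeRateTransferAnalyticKKTCurve (hasDerivAt_effForm_curve hasDerivAt_minOp_curve)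

/-! ## §1 The one-step effective form: an2's composition law at `G = 0` (any field) -/

section Comp

variable {𝕜 : Type*} [Field 𝕜]
variable {ν μ κ : Type*} [Fintype ν] [Fintype μ] [Fintype κ] [DecidableEq ν] [DecidableEq μ] [DecidableEq κ]

/-- **`effForm_oneStep_comp`** [folklore; an2's `effForm_compForm` at `G = 0`, PART 41's `tE`]: `𝒮(𝒮(H′,q), Q) = 𝒮(H′, Q·q)` — averaging in two steps through the
one-step effective form `Λ := 𝒮(H′,q)` is averaging at once. -/
theorem effForm_oneStep_comp (H' : Matrix ν ν 𝕜) (q : Matrix μ ν 𝕜) (Q : Matrix κ μ 𝕜) (hq : IsUnit (kkt H' q).det)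
    (hΛ : IsUnit (kkt (effForm H' q) Q).det) : effForm (effForm H' q) Q = effForm H' (Q * q) := by
  have hΛ0 : IsUnit (kkt (effForm H' q + 0) Q).det := by rwa [add_zero]
  have := effForm_compForm H' q 0 Q hq hΛ0
  rw [compForm_zero, add_zero] at this
  exact this.symm

/-- **`minOp_oneStep_comp`** [folklore; an2's `minOp_compForm` at `G = 0`, PART 41's `tM ∕ hqP`]: `ℋ(𝒮(H′,q), Q) = q·ℋ(H′, Q·q)` — the minimiser of the one-step
effective form IS the one-step average of the composite minimiser (`ℋ̃_j = Qf_j·ℋ_{j+1}`). -/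
theorem minOp_oneStep_comp (H' : Matrix ν ν 𝕜) (q : Matrix μ ν 𝕜) (Q : Matrix κ μ 𝕜) (hq : IsUnit (kkt H' q).det)
    (hΛ : IsUnit (kkt (effForm H' q) Q).det) : minOp (effForm H' q) Q = q * minOp H' (Q * q) := by
  have hΛ0 : IsUnit (kkt (effForm H' q + 0) Q).det := by rwa [add_zero]
  have tM : minOp H' (Q * q) = minOp H' q * minOp (effForm H' q) Q := by
    have := minOp_compForm H' q 0 Q hq hΛ0
    rwa [compForm_zero, add_zero] at this
  rw [tM, ← Matrix.mul_assoc, mul_minOp H' q hq, Matrix.one_mul]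

/-- **`isUnit_det_kkt_oneStep`** [folklore; an2's `det_kkt_compForm_ne_zero_iff` at `G = 0`]: the bordered matrix of the one-step effective form is nonsingular as
soon as the one-step and the composite bordered matrices are: `kkt H′ q`, `kkt H′ (Q·q)` nonsingular ⟹ `kkt (𝒮(H′,q)) Q` nonsingular (so the tower ENDs below need no
separate hypothesis on `kkt Λ_j (Qc j)`). -/
theorem isUnit_det_kkt_oneStep (H' : Matrix ν ν 𝕜) (q : Matrix μ ν 𝕜) (Q : Matrix κ μ 𝕜) (hq : IsUnit (kkt H' q).det)
    (hQq : IsUnit (kkt H' (Q * q)).det) : IsUnit (kkt (effForm H' q) Q).det := by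
  have h0 : (kkt (compForm H' q 0) (Q * q)).det ≠ 0 := by rw [compForm_zero]; exact hQq.ne_zero
  have h := (det_kkt_compForm_ne_zero_iff H' q 0 Q hq).mp h0
  rw [add_zero] at h
  exact isUnit_iff_ne_zero.mpr h

end Comp

/-! ## §2 `D₀ ⪰ 0 ⟸ (STAB)` in bordered letters; the (CONS) step polarised -/

section Defect

variable {c ν ν' : Type*} [Fintype c] [Fintype ν] [Fintype ν'] [DecidableEq c] [DecidableEq ν] [DecidableEq ν']
variable {H : Matrix ν ν ℝ} {Q : Matrix c ν ℝ} {H' : Matrix ν' ν' ℝ} {Q' : Matrix c ν' ℝ} {q : Matrix ν ν' ℝ} {P : Matrix ν' ν ℝ}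

/-- **`oneStep_defect_posSemidef_of_stab` — `D₀ ⪰ 0 ⟸ (STAB)`** [our proof; ROUTES-GAN24 v48 R6 NOTE (b) in bordered letters, singular fine forms allowed]: `H` symmetric,
`H′ ⪰ 0`, `kkt H′ q` nonsingular, (STAB) `qᵀHq ≤ H′` ⟹ `𝒮(H′, q) − H ⪰ 0` (at one vector: `⟨v,Hv⟩ = ⟨qℋ′v, H qℋ′v⟩ ≤ ⟨ℋ′v, H′ℋ′v⟩ = ⟨v, 𝒮(H′,q)v⟩`). -/
theorem oneStep_defect_posSemidef_of_stab (hHs : Hᵀ = H) (hH' : H'.PosSemidef) (hq : IsUnit (kkt H' q).det)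
    (hstab : (H' - qᵀ * H * q).PosSemidef) : (effForm H' q - H).PosSemidef := by
  have hS' : (effForm H' q)ᵀ = effForm H' q := (minOpL_eq_transpose H' q (transpose_eq_of_posSemidef hH')).2.2
  refine PosSemidef.of_dotProduct_mulVec_nonneg ?_ fun v => ?_
  · rw [Matrix.IsHermitian, Matrix.conjTranspose_eq_transpose_of_trivial, transpose_sub, hS', hHs]
  · simp only [star_trivial, sub_mulVec, dotProduct_sub, sub_nonneg]
    set u : ν' → ℝ := minOp H' q *ᵥ v with hu
    have hqu : q *ᵥ u = v := by rw [hu]; exact mulVec_minOp hq v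
    have h2 := hstab.dotProduct_mulVec_nonneg u
    simp only [star_trivial, sub_mulVec, dotProduct_sub, sub_nonneg] at h2
    rw [dotProduct_effForm_eq_energy hq v, ← hu]
    calc v ⬝ᵥ (H *ᵥ v) = (q *ᵥ u) ⬝ᵥ (H *ᵥ (q *ᵥ u)) := by rw [hqu]
      _ = u ⬝ᵥ ((qᵀ * H * q) *ᵥ u) := by rw [mulVec_dotProduct_eq, mulVec_mulVec, mulVec_mulVec, Matrix.mul_assoc]
      _ ≤ u ⬝ᵥ (H' *ᵥ u) := h2

/-- **`oneStep_defect_form_le_of_prol` — THE KERNEL ROW `c_D` FROM A PROLONGATION ROW** [our proof; gan24-idea-1 g49 (b) «c_D ≤ C_Λ − 1 by the piecewise-constant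
trial field»]: `H′ ⪰ 0`, `kkt H′ q` nonsingular, ANY right inverse `P` of the one-step averaging (`q·P = 1`) and a (PROL)-type form row `PᵀH′P ≤ (1 + ε)H + δG` ⟹
`⟨w,(𝒮(H′,q) − H)w⟩ ≤ ε⟨w,Hw⟩ + δ⟨w,Gw⟩` for every `w` (trial field `Pw`: `⟨w,𝒮(H′,q)w⟩ ≤ ⟨Pw,H′Pw⟩`).  In the flat model class (Laplacians `η^{d−2}Δ`, block means,
piecewise-constant `P`) `PᵀH_{j+1}P = L·H_j` exactly, so `ε = L − 1`, `δ = 0` — the kernel row of §3's H-side END with `c_D = L − 1` (idea-1 t49: 1.0000 at L = 2). -/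
theorem oneStep_defect_form_le_of_prol {G : Matrix ν ν ℝ} (hH' : H'.PosSemidef) (hq : IsUnit (kkt H' q).det) (hqP : q * P = 1) {ε δ : ℝ}
    (hprol : ∀ w : ν → ℝ, (P *ᵥ w) ⬝ᵥ (H' *ᵥ (P *ᵥ w)) ≤ (1 + ε) * (w ⬝ᵥ (H *ᵥ w)) + δ * (w ⬝ᵥ (G *ᵥ w))) (w : ν → ℝ) :
    w ⬝ᵥ ((effForm H' q - H) *ᵥ w) ≤ ε * (w ⬝ᵥ (H *ᵥ w)) + δ * (w ⬝ᵥ (G *ᵥ w)) := by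
  have hadm : q *ᵥ (P *ᵥ w) = w := by rw [mulVec_mulVec, hqP, one_mulVec]
  have h1 := dotProduct_effForm_le_trial hH' hq hadm
  have h2 := hprol w
  rw [sub_mulVec, dotProduct_sub]
  linarith

/-- **`dotProduct_effForm_step_le_cons` — THE (CONS) STEP, POLARISED** [our proof; PART 18 `effForm_step_diag_le_cons` at every vector]: `H′ ⪰ 0`, nonsingular bordered
matrices, `Q′P = Q` ⟹ `⟨v, (𝒮(H′,Q′) − 𝒮(H,Q))v⟩ ≤ ⟨ℋv, (PᵀH′P − H)ℋv⟩` (the prolongated minimiser `Pℋv` is admissible one level up). -/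
theorem dotProduct_effForm_step_le_cons (hH' : H'.PosSemidef) (h : IsUnit (kkt H Q).det) (h' : IsUnit (kkt H' Q').det) (hPQ : Q' * P = Q)
    (v : c → ℝ) :
    v ⬝ᵥ ((effForm H' Q' - effForm H Q) *ᵥ v) ≤ (minOp H Q *ᵥ v) ⬝ᵥ ((Pᵀ * H' * P - H) *ᵥ (minOp H Q *ᵥ v)) := by
  set m : ν → ℝ := minOp H Q *ᵥ v with hm
  have hadm : Q' *ᵥ (P *ᵥ m) = v := by rw [mulVec_mulVec, hPQ, hm, mulVec_minOp h]
  have h1 := dotProduct_effForm_le_trial hH' h' hadm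
  have h2 : v ⬝ᵥ (effForm H Q *ᵥ v) = m ⬝ᵥ (H *ᵥ m) := by rw [hm, ← dotProduct_effForm_eq_energy h]
  have h3 : (P *ᵥ m) ⬝ᵥ (H' *ᵥ (P *ᵥ m)) = m ⬝ᵥ ((Pᵀ * H' * P) *ᵥ m) := by
    rw [mulVec_dotProduct_eq, mulVec_mulVec, mulVec_mulVec, Matrix.mul_assoc]
  rw [sub_mulVec, dotProduct_sub, h2, sub_mulVec, dotProduct_sub, ← h3]
  linarith

/-- **`effForm_step_form_le_of_cons`** [our proof]: a FORM-LEVEL (CONS) `⟨ℋv,(PᵀH′P − H)ℋv⟩ ≤ κ·⟨v,v⟩` IS the value row of PART 42 §5: `⟨v,(𝒮′ − 𝒮)v⟩ ≤ κ·⟨v,v⟩`. -/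
theorem effForm_step_form_le_of_cons (hH' : H'.PosSemidef) (h : IsUnit (kkt H Q).det) (h' : IsUnit (kkt H' Q').det) (hPQ : Q' * P = Q)
    {κ : ℝ} (hcons : ∀ v : c → ℝ, (minOp H Q *ᵥ v) ⬝ᵥ ((Pᵀ * H' * P - H) *ᵥ (minOp H Q *ᵥ v)) ≤ κ * (v ⬝ᵥ v)) (v : c → ℝ) :
    v ⬝ᵥ ((effForm H' Q' - effForm H Q) *ᵥ v) ≤ κ * (v ⬝ᵥ v) :=
  (dotProduct_effForm_step_le_cons hH' h h' hPQ v).trans (hcons v)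

omit [DecidableEq c] in
/-- **`form_le_of_abs_rowSum_le` — THE CURRENCY JUNCTION (Schur test)** [folklore]: a symmetric real matrix with absolute row sums `≤ R` is `≤ R` as a form:
`⟨x,Mx⟩ ≤ R·⟨x,x⟩`.  This is how C-R6°'s ENTRYWISE value rate with decay (`|𝒮_{j+1}(a,b) − 𝒮_j(a,b)| ≤ cst·θ^j·w(a,b)`, `Σ_b w(a,b) ≤ W` uniformly in the
volume) becomes the FORM-currency value row of §3 with `c_S = cst·W` (volume-independent); conversely PART 18 §1 `abs_apply_le_of_diag_le` returns from forms to
entries. -/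
theorem form_le_of_abs_rowSum_le {M : Matrix c c ℝ} (hM : Mᵀ = M) {R : ℝ} (hrow : ∀ a, ∑ b, |M a b| ≤ R) (x : c → ℝ) :
    x ⬝ᵥ (M *ᵥ x) ≤ R * (x ⬝ᵥ x) := by
  have hsym : ∀ a b, M a b = M b a := fun a b => by
    have h := congrFun (congrFun hM b) a
    rwa [Matrix.transpose_apply] at h
  have hcol : ∀ b, ∑ a, |M a b| ≤ R := fun b => by simpa only [hsym] using hrow b
  have e1 : x ⬝ᵥ (M *ᵥ x) = ∑ a, ∑ b, M a b * (x a * x b) := by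
    simp only [dotProduct, mulVec, Finset.mul_sum]
    refine Finset.sum_congr rfl fun a _ => Finset.sum_congr rfl fun b _ => by ring
  have e2 : x ⬝ᵥ x = ∑ a, x a ^ 2 := by simp only [dotProduct, sq]
  have hterm : ∀ a b, M a b * (x a * x b) ≤ x a ^ 2 / 2 * |M a b| + x b ^ 2 / 2 * |M a b| := fun a b => by
    have h1 : M a b * (x a * x b) ≤ |M a b| * |x a * x b| := by rw [← abs_mul]; exact le_abs_self _
    have h2 : |x a * x b| ≤ (x a ^ 2 + x b ^ 2) / 2 := by
      rw [abs_mul]; nlinarith [sq_nonneg (|x a| - |x b|), sq_abs (x a), sq_abs (x b), abs_nonneg (x a), abs_nonneg (x b)]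
    nlinarith [abs_nonneg (M a b)]
  have hA : ∑ a, ∑ b, x a ^ 2 / 2 * |M a b| ≤ ∑ a, x a ^ 2 / 2 * R := by
    refine Finset.sum_le_sum fun a _ => ?_
    rw [← Finset.mul_sum]
    exact mul_le_mul_of_nonneg_left (hrow a) (by positivity)
  have hB : ∑ a, ∑ b, x b ^ 2 / 2 * |M a b| ≤ ∑ b, x b ^ 2 / 2 * R := by
    rw [Finset.sum_comm]
    refine Finset.sum_le_sum fun b _ => ?_
    rw [← Finset.mul_sum]
    exact mul_le_mul_of_nonneg_left (hcol b) (by positivity)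
  rw [e1, e2]
  calc ∑ a, ∑ b, M a b * (x a * x b)
      ≤ ∑ a, ∑ b, (x a ^ 2 / 2 * |M a b| + x b ^ 2 / 2 * |M a b|) := Finset.sum_le_sum fun a _ => Finset.sum_le_sum fun b _ => hterm a b
    _ = ∑ a, ∑ b, x a ^ 2 / 2 * |M a b| + ∑ a, ∑ b, x b ^ 2 / 2 * |M a b| := by simp only [Finset.sum_add_distrib]
    _ ≤ ∑ a, x a ^ 2 / 2 * R + ∑ b, x b ^ 2 / 2 * R := add_le_add hA hB
    _ = R * ∑ a, x a ^ 2 := by rw [← Finset.sum_add_distrib, Finset.mul_sum]; exact Finset.sum_congr rfl fun a _ => by ring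

/-- **`jet_constrained_energy_H_le_of_rows` — THE H-SIDE JET AT ONE LEVEL** [our proof; gan24-idea-1 g49 (b) «parallelogram in the `D₀`-seminorm»]: for the jet
of the `H`-minimiser `dℋ(H,Q;H₁,Q₁)e = 𝒢_H f₁ + ℋ_H(−u₁)` (`f₁ = (Q₁ᵀ𝒮_H − H₁ℋ_H)e`, `u₁ = Q₁ℋ_H e`; PART 42 (J)) the extra KERNEL row `Λ − H ≤ c_D·H on ker Q`
gives `⟨dℋe,(Λ − H)dℋe⟩ ≤ 4(1 + c_D)·(C_G·F + C_S·U)` from the same (FLUC-OP) ∕ value ∕ (SRC) rows (PART 42 `constrained_energy_H_le` + `pairing_sub_le_two_rows`). -/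
theorem jet_constrained_energy_H_le_of_rows {ν' : Type*} [Fintype ν'] [DecidableEq ν'] {K Λ : Matrix ν' ν' ℝ} {Qk : Matrix c ν' ℝ}
    (hKp : K.PosSemidef) (hΛs : Λᵀ = Λ) (hD : (Λ - K).PosSemidef) (hK : IsUnit (kkt K Qk).det) (hΛ : IsUnit (kkt Λ Qk).det)
    (K₁ : Matrix ν' ν' ℝ) (Q₁ : Matrix c ν' ℝ) (e : c → ℝ) {cD CG CS F U : ℝ} (hcD : 0 ≤ cD) (hCG : 0 ≤ CG) (hCS : 0 ≤ CS)
    (hker : ∀ w : ν' → ℝ, Qk *ᵥ w = 0 → w ⬝ᵥ ((Λ - K) *ᵥ w) ≤ cD * (w ⬝ᵥ (K *ᵥ w)))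
    (hG : ∀ x : ν' → ℝ, x ⬝ᵥ ((flucCov K Qk - flucCov Λ Qk) *ᵥ x) ≤ CG * (x ⬝ᵥ x))
    (hS : ∀ y : c → ℝ, y ⬝ᵥ ((effForm Λ Qk - effForm K Qk) *ᵥ y) ≤ CS * (y ⬝ᵥ y))
    (hF : ((Q₁ᵀ * effForm K Qk - K₁ * minOp K Qk) *ᵥ e) ⬝ᵥ ((Q₁ᵀ * effForm K Qk - K₁ * minOp K Qk) *ᵥ e) ≤ F)
    (hU : ((Q₁ * minOp K Qk) *ᵥ e) ⬝ᵥ ((Q₁ * minOp K Qk) *ᵥ e) ≤ U) :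
    (dMinOp K Qk K₁ Q₁ *ᵥ e) ⬝ᵥ ((Λ - K) *ᵥ (dMinOp K Qk K₁ Q₁ *ᵥ e)) ≤ 4 * (1 + cD) * (CG * F + CS * U) := by
  set f : ν' → ℝ := (Q₁ᵀ * effForm K Qk - K₁ * minOp K Qk) *ᵥ e with hf
  set u : c → ℝ := (-(Q₁ * minOp K Qk)) *ᵥ e with hu
  have h1 := constrained_energy_H_le hKp hΛs hD hK hΛ hcD hker f u
  have h2 := pairing_sub_le_two_rows hKp hΛs hD hK hΛ f u
  have huu : u ⬝ᵥ ((effForm Λ Qk - effForm K Qk) *ᵥ u) = ((Q₁ * minOp K Qk) *ᵥ e) ⬝ᵥ ((effForm Λ Qk - effForm K Qk) *ᵥ ((Q₁ * minOp K Qk) *ᵥ e)) := by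
    rw [hu, neg_mulVec, mulVec_neg, neg_dotProduct, dotProduct_neg, neg_neg]
  have hG' := hG f
  have hS' := hS ((Q₁ * minOp K Qk) *ᵥ e)
  rw [dMinOp_mulVec_eq_kktPoint, ← hf, ← hu]
  have h12 : (flucCov K Qk *ᵥ f + minOp K Qk *ᵥ u) ⬝ᵥ ((Λ - K) *ᵥ (flucCov K Qk *ᵥ f + minOp K Qk *ᵥ u)) ≤
      2 * (1 + cD) * (2 * (CG * F + CS * U)) := by
    refine h1.trans (mul_le_mul_of_nonneg_left (h2.trans ?_) (by positivity))
    rw [huu]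
    nlinarith [mul_le_mul_of_nonneg_left hF hCG, mul_le_mul_of_nonneg_left hU hCS]
  linarith

/-- **`jet₂_constrained_energy_le_of_rows` — THE SECOND-ORDER ROW AT ONE LEVEL** [our proof; PART 42 (J) `jet₂_minOp_eq_kktPoint` + `dMinOp_eq_kktPoint`]: along a polynomial
line of data `t ↦ (Λ + tΛ₁ + t²Λ₂, Q + tQ₁ + t²Q₂)` the `t²`-coefficient of the minimiser is `(jet₂ Λ Q Λ₁ Q₁ Λ₁ Q₁)₁₂ + dℋ(Λ,Q;Λ₂,Q₂)` (an1's `minOp_effForm_line_taylor₂`),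
again a KKT point with sources `f₂ = (Q₁ᵀd𝒮′ − Λ₁dℋ′)e + (Q₂ᵀ𝒮_Λ − Λ₂ℋ_Λ)e`, `u₂ = (Q₁dℋ′ + Q₂ℋ_Λ)e` (`dℋ′ = dℋ(Λ,Q;Λ₁,Q₁)`, `d𝒮′ = d𝒮(Λ,Q;Λ₁,Q₁)`); hence under
(FLUC-OP), the value row and second-order (SRC) bounds `⟨f₂,f₂⟩ ≤ F₂`, `⟨u₂,u₂⟩ ≤ U₂`: `‖v₂‖²_{Λ−H} ≤ 2(C_G·F₂ + C_S·U₂)` (legs T002 of PART 41's second-order split). -/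
theorem jet₂_constrained_energy_le_of_rows {ν' : Type*} [Fintype ν'] [DecidableEq ν'] {K Λ : Matrix ν' ν' ℝ} {Qk : Matrix c ν' ℝ}
    (hKp : K.PosSemidef) (hΛs : Λᵀ = Λ) (hD : (Λ - K).PosSemidef) (hK : IsUnit (kkt K Qk).det) (hΛ : IsUnit (kkt Λ Qk).det)
    (Λ₁ Λ₂ : Matrix ν' ν' ℝ) (Q₁ Q₂ : Matrix c ν' ℝ) (e : c → ℝ) {CG CS F₂ U₂ : ℝ} (hCG : 0 ≤ CG) (hCS : 0 ≤ CS)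
    (hG : ∀ x : ν' → ℝ, x ⬝ᵥ ((flucCov K Qk - flucCov Λ Qk) *ᵥ x) ≤ CG * (x ⬝ᵥ x))
    (hS : ∀ y : c → ℝ, y ⬝ᵥ ((effForm Λ Qk - effForm K Qk) *ᵥ y) ≤ CS * (y ⬝ᵥ y))
    (hF : ((Q₁ᵀ * dEffForm Λ Qk Λ₁ Q₁ - Λ₁ * dMinOp Λ Qk Λ₁ Q₁ + (Q₂ᵀ * effForm Λ Qk - Λ₂ * minOp Λ Qk)) *ᵥ e) ⬝ᵥ
        ((Q₁ᵀ * dEffForm Λ Qk Λ₁ Q₁ - Λ₁ * dMinOp Λ Qk Λ₁ Q₁ + (Q₂ᵀ * effForm Λ Qk - Λ₂ * minOp Λ Qk)) *ᵥ e) ≤ F₂)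
    (hU : ((Q₁ * dMinOp Λ Qk Λ₁ Q₁ + Q₂ * minOp Λ Qk) *ᵥ e) ⬝ᵥ ((Q₁ * dMinOp Λ Qk Λ₁ Q₁ + Q₂ * minOp Λ Qk) *ᵥ e) ≤ U₂) :
    ((jet₂ Λ Qk Λ₁ Q₁ Λ₁ Q₁).toBlocks₁₂ *ᵥ e + dMinOp Λ Qk Λ₂ Q₂ *ᵥ e) ⬝ᵥ
        ((Λ - K) *ᵥ ((jet₂ Λ Qk Λ₁ Q₁ Λ₁ Q₁).toBlocks₁₂ *ᵥ e + dMinOp Λ Qk Λ₂ Q₂ *ᵥ e)) ≤ 2 * (CG * F₂ + CS * U₂) := by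
  set f : ν' → ℝ := (Q₁ᵀ * dEffForm Λ Qk Λ₁ Q₁ - Λ₁ * dMinOp Λ Qk Λ₁ Q₁ + (Q₂ᵀ * effForm Λ Qk - Λ₂ * minOp Λ Qk)) *ᵥ e with hf
  set u : c → ℝ := (-(Q₁ * dMinOp Λ Qk Λ₁ Q₁ + Q₂ * minOp Λ Qk)) *ᵥ e with hu
  have hM : (jet₂ Λ Qk Λ₁ Q₁ Λ₁ Q₁).toBlocks₁₂ + dMinOp Λ Qk Λ₂ Q₂ =
      flucCov Λ Qk * (Q₁ᵀ * dEffForm Λ Qk Λ₁ Q₁ - Λ₁ * dMinOp Λ Qk Λ₁ Q₁ + (Q₂ᵀ * effForm Λ Qk - Λ₂ * minOp Λ Qk)) +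
        minOp Λ Qk * (-(Q₁ * dMinOp Λ Qk Λ₁ Q₁ + Q₂ * minOp Λ Qk)) := by
    rw [jet₂_minOp_eq_kktPoint Λ Λ₁ Λ₁ Qk Q₁ Q₁, dMinOp_eq_kktPoint Λ Λ₂ Qk Q₂, Matrix.mul_add (flucCov Λ Qk), neg_add,
      Matrix.mul_add (minOp Λ Qk)]
    abel
  have hv : (jet₂ Λ Qk Λ₁ Q₁ Λ₁ Q₁).toBlocks₁₂ *ᵥ e + dMinOp Λ Qk Λ₂ Q₂ *ᵥ e = flucCov Λ Qk *ᵥ f + minOp Λ Qk *ᵥ u := by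
    rw [← add_mulVec, hM, add_mulVec, ← mulVec_mulVec, ← mulVec_mulVec]
  have huu : u ⬝ᵥ u = ((Q₁ * dMinOp Λ Qk Λ₁ Q₁ + Q₂ * minOp Λ Qk) *ᵥ e) ⬝ᵥ ((Q₁ * dMinOp Λ Qk Λ₁ Q₁ + Q₂ * minOp Λ Qk) *ᵥ e) := by
    rw [hu, neg_mulVec, neg_dotProduct, dotProduct_neg, neg_neg]
  rw [hv]
  refine (constrained_energy_le_of_rows hKp hΛs hD hK hΛ hG hS f u).trans ?_
  rw [huu]
  nlinarith [mul_le_mul_of_nonneg_left hF hCG, mul_le_mul_of_nonneg_left hU hCS]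

end Defect

/-! ## §3 The tower END: (CONS♭)(j) from k-uniform (FLUC-OP) + (SRC) + the value row + (STAB) -/

section Tower

variable {c : Type*} [Fintype c] [DecidableEq c]
variable {ι : ℕ → Type*} [∀ j, Fintype (ι j)] [∀ j, DecidableEq (ι j)]
variable {H : ∀ j, Matrix (ι j) (ι j) ℝ} {Qf : ∀ j, Matrix (ι j) (ι (j + 1)) ℝ} {Qc : ∀ j, Matrix c (ι j) ℝ}
variable {Λ₁ : ∀ j, Matrix (ι j) (ι j) ℝ} {Q₁ : ∀ j, Matrix c (ι j) ℝ} {P : ∀ j, Matrix (ι (j + 1)) (ι j) ℝ}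
variable {CG cS cF cU θ : ℝ}

/-- **`jetRange_cons_rate_of_rows` — (CONS♭) ALONG THE TOWER ⟸ (FLUC-OP) + (SRC) + THE VALUE ROW + (STAB)** [our proof; gan24-idea-1 g49 LENS ITEM 6 in kernel
form].  With `Λ_j := 𝒮(H (j+1), Qf j)`, `ℋ̃_j := Qf j·ℋ_{j+1}`, `𝒮_k := 𝒮(H k, Qc k)` and the jet `ℋ̃_{j,1} := dℋ(Λ_j, Qc_j; Λ₁ j, Q₁ j)` with sources
`f_{j,1}e = ((Q₁ j)ᵀ𝒮_{j+1} − Λ₁ j·ℋ̃_j)e`, `u_{j,1}e = (Q₁ j·ℋ̃_j)e`: PSD fine forms, nonsingular bordered matrices `kkt (H j) (Qc j)`, `kkt (H (j+1)) (Qf j)`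
(hence `kkt Λ_j (Qc j)`, §1), `Qc (j+1) = Qc j · Qf j`, (STAB_j) `(Qf j)ᵀ H_j (Qf j) ≤ H_{j+1}`, `0 ≤ C_G, c_S, θ`, and for all `j`:
(FLUC-OP) `⟨x,(𝒢(H_j,Qc_j) − 𝒢(Λ_j,Qc_j))x⟩ ≤ C_G⟨x,x⟩`; (CONS value) `⟨y,(𝒮_{j+1} − 𝒮_j)y⟩ ≤ c_S θ^j⟨y,y⟩`; (SRC) `⟨f_{j,1}e,f_{j,1}e⟩ ≤ c_F θ^j⟨e,e⟩`,
`⟨u_{j,1}e,u_{j,1}e⟩ ≤ c_U⟨e,e⟩` ⟹ **`⟨ℋ̃_{j,1}e, (Λ_j − H_j)ℋ̃_{j,1}e⟩ ≤ 2(C_G·c_F + c_S·c_U)·θ^j·⟨e,e⟩` for all `j, e`.** -/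
theorem jetRange_cons_rate_of_rows (hH : ∀ j, (H j).PosSemidef) (hk : ∀ j, IsUnit (kkt (H j) (Qc j)).det)
    (hkf : ∀ j, IsUnit (kkt (H (j + 1)) (Qf j)).det) (hcomp : ∀ j, Qc (j + 1) = Qc j * Qf j)
    (hstab : ∀ j, (H (j + 1) - (Qf j)ᵀ * H j * Qf j).PosSemidef) (hCG : 0 ≤ CG) (hcS : 0 ≤ cS) (hθ : 0 ≤ θ)
    (hG : ∀ j (x : ι j → ℝ), x ⬝ᵥ ((flucCov (H j) (Qc j) - flucCov (effForm (H (j + 1)) (Qf j)) (Qc j)) *ᵥ x) ≤ CG * (x ⬝ᵥ x))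
    (hS : ∀ j (y : c → ℝ), y ⬝ᵥ ((effForm (H (j + 1)) (Qc (j + 1)) - effForm (H j) (Qc j)) *ᵥ y) ≤ cS * θ ^ j * (y ⬝ᵥ y))
    (hF : ∀ j (e : c → ℝ),
      (((Q₁ j)ᵀ * effForm (H (j + 1)) (Qc (j + 1)) - Λ₁ j * (Qf j * minOp (H (j + 1)) (Qc (j + 1)))) *ᵥ e) ⬝ᵥ
          (((Q₁ j)ᵀ * effForm (H (j + 1)) (Qc (j + 1)) - Λ₁ j * (Qf j * minOp (H (j + 1)) (Qc (j + 1)))) *ᵥ e) ≤ cF * θ ^ j * (e ⬝ᵥ e))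
    (hU : ∀ j (e : c → ℝ), ((Q₁ j * (Qf j * minOp (H (j + 1)) (Qc (j + 1)))) *ᵥ e) ⬝ᵥ ((Q₁ j * (Qf j * minOp (H (j + 1)) (Qc (j + 1)))) *ᵥ e) ≤
      cU * (e ⬝ᵥ e)) :
    ∀ j (e : c → ℝ), (dMinOp (effForm (H (j + 1)) (Qf j)) (Qc j) (Λ₁ j) (Q₁ j) *ᵥ e) ⬝ᵥ
        ((effForm (H (j + 1)) (Qf j) - H j) *ᵥ (dMinOp (effForm (H (j + 1)) (Qf j)) (Qc j) (Λ₁ j) (Q₁ j) *ᵥ e)) ≤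
      2 * (CG * cF + cS * cU) * θ ^ j * (e ⬝ᵥ e) := fun j e => by
  have hHs : (H j)ᵀ = H j := transpose_eq_of_posSemidef (hH j)
  have hkΛ : IsUnit (kkt (effForm (H (j + 1)) (Qf j)) (Qc j)).det :=
    isUnit_det_kkt_oneStep _ _ _ (hkf j) (by rw [← hcomp j]; exact hk (j + 1))
  have hΛs : (effForm (H (j + 1)) (Qf j))ᵀ = effForm (H (j + 1)) (Qf j) :=
    (minOpL_eq_transpose (H (j + 1)) (Qf j) (transpose_eq_of_posSemidef (hH (j + 1)))).2.2
  have hD : (effForm (H (j + 1)) (Qf j) - H j).PosSemidef := oneStep_defect_posSemidef_of_stab hHs (hH (j + 1)) (hkf j) (hstab j)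
  have tE : effForm (effForm (H (j + 1)) (Qf j)) (Qc j) = effForm (H (j + 1)) (Qc (j + 1)) := by
    rw [hcomp j]; exact effForm_oneStep_comp (H (j + 1)) (Qf j) (Qc j) (hkf j) hkΛ
  have tM : minOp (effForm (H (j + 1)) (Qf j)) (Qc j) = Qf j * minOp (H (j + 1)) (Qc (j + 1)) := by
    rw [hcomp j]; exact minOp_oneStep_comp (H (j + 1)) (Qf j) (Qc j) (hkf j) hkΛ
  have hθj : 0 ≤ θ ^ j := pow_nonneg hθ j
  have key := jet_constrained_energy_le_of_rows (CS := cS * θ ^ j) (F := cF * θ ^ j * (e ⬝ᵥ e)) (U := cU * (e ⬝ᵥ e)) (hH j) hΛs hD (hk j)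
    hkΛ (Λ₁ j) (Q₁ j) e hCG (mul_nonneg hcS hθj) (hG j) (fun y => by rw [tE]; exact hS j y) (by rw [tE, tM]; exact hF j e)
    (by rw [tM]; exact hU j e)
  calc _ ≤ 2 * (CG * (cF * θ ^ j * (e ⬝ᵥ e)) + cS * θ ^ j * (cU * (e ⬝ᵥ e))) := key
    _ = 2 * (CG * cF + cS * cU) * θ ^ j * (e ⬝ᵥ e) := by ring

/-- **`jetRange_cons_rate_of_cons` — THE SAME WITH THE VALUE ROW TRACED TO A FORM-LEVEL (CONS)** [our proof]: replace the value row by an averaging-compatible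
prolongation `Qc (j+1)·P j = Qc j` and (CONS_j) `⟨ℋ_j v,((P j)ᵀH_{j+1}(P j) − H_j)ℋ_j v⟩ ≤ c_S·θ^j·⟨v,v⟩` (§2 `effForm_step_form_le_of_cons`). -/
theorem jetRange_cons_rate_of_cons (hH : ∀ j, (H j).PosSemidef) (hk : ∀ j, IsUnit (kkt (H j) (Qc j)).det)
    (hkf : ∀ j, IsUnit (kkt (H (j + 1)) (Qf j)).det) (hcomp : ∀ j, Qc (j + 1) = Qc j * Qf j) (hPQ : ∀ j, Qc (j + 1) * P j = Qc j)
    (hstab : ∀ j, (H (j + 1) - (Qf j)ᵀ * H j * Qf j).PosSemidef) (hCG : 0 ≤ CG) (hcS : 0 ≤ cS) (hθ : 0 ≤ θ)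
    (hG : ∀ j (x : ι j → ℝ), x ⬝ᵥ ((flucCov (H j) (Qc j) - flucCov (effForm (H (j + 1)) (Qf j)) (Qc j)) *ᵥ x) ≤ CG * (x ⬝ᵥ x))
    (hcons : ∀ j (v : c → ℝ), (minOp (H j) (Qc j) *ᵥ v) ⬝ᵥ (((P j)ᵀ * H (j + 1) * P j - H j) *ᵥ (minOp (H j) (Qc j) *ᵥ v)) ≤
      cS * θ ^ j * (v ⬝ᵥ v))
    (hF : ∀ j (e : c → ℝ),
      (((Q₁ j)ᵀ * effForm (H (j + 1)) (Qc (j + 1)) - Λ₁ j * (Qf j * minOp (H (j + 1)) (Qc (j + 1)))) *ᵥ e) ⬝ᵥ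
          (((Q₁ j)ᵀ * effForm (H (j + 1)) (Qc (j + 1)) - Λ₁ j * (Qf j * minOp (H (j + 1)) (Qc (j + 1)))) *ᵥ e) ≤ cF * θ ^ j * (e ⬝ᵥ e))
    (hU : ∀ j (e : c → ℝ), ((Q₁ j * (Qf j * minOp (H (j + 1)) (Qc (j + 1)))) *ᵥ e) ⬝ᵥ ((Q₁ j * (Qf j * minOp (H (j + 1)) (Qc (j + 1)))) *ᵥ e) ≤
      cU * (e ⬝ᵥ e)) :
    ∀ j (e : c → ℝ), (dMinOp (effForm (H (j + 1)) (Qf j)) (Qc j) (Λ₁ j) (Q₁ j) *ᵥ e) ⬝ᵥ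
        ((effForm (H (j + 1)) (Qf j) - H j) *ᵥ (dMinOp (effForm (H (j + 1)) (Qf j)) (Qc j) (Λ₁ j) (Q₁ j) *ᵥ e)) ≤
      2 * (CG * cF + cS * cU) * θ ^ j * (e ⬝ᵥ e) :=
  jetRange_cons_rate_of_rows hH hk hkf hcomp hstab hCG hcS hθ hG
    (fun j y => effForm_step_form_le_of_cons (hH (j + 1)) (hk j) (hk (j + 1)) (hPQ j) (hcons j) y) hF hU

/-- **`jetRange_cons_rate_H_of_rows` — THE H-SIDE ROW ALONG THE TOWER** [our proof]: the jet of the level-`j` minimiser itself, `ℋ_{j,1} := dℋ(H_j, Qc_j; H₁ j, Q₁ j)`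
(sources `f^H_{j,1}e = ((Q₁ j)ᵀ𝒮_j − H₁ j·ℋ_j)e`, `u^H_{j,1}e = (Q₁ j·ℋ_j)e`), under the same rows plus the k-uniform KERNEL row `Λ_j − H_j ≤ c_D·H_j on ker Qc_j`:
`⟨ℋ_{j,1}e, (Λ_j − H_j)ℋ_{j,1}e⟩ ≤ 4(1 + c_D)(C_G·c_F + c_S·c_U)·θ^j·⟨e,e⟩` for all `j, e` (the leg I of PART 41's first-order split; §3's row is the leg III). -/
theorem jetRange_cons_rate_H_of_rows {H₁ : ∀ j, Matrix (ι j) (ι j) ℝ} {cD : ℝ} (hH : ∀ j, (H j).PosSemidef)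
    (hk : ∀ j, IsUnit (kkt (H j) (Qc j)).det) (hkf : ∀ j, IsUnit (kkt (H (j + 1)) (Qf j)).det) (hcomp : ∀ j, Qc (j + 1) = Qc j * Qf j)
    (hstab : ∀ j, (H (j + 1) - (Qf j)ᵀ * H j * Qf j).PosSemidef) (hcD : 0 ≤ cD) (hCG : 0 ≤ CG) (hcS : 0 ≤ cS) (hθ : 0 ≤ θ)
    (hker : ∀ j (w : ι j → ℝ), Qc j *ᵥ w = 0 → w ⬝ᵥ ((effForm (H (j + 1)) (Qf j) - H j) *ᵥ w) ≤ cD * (w ⬝ᵥ (H j *ᵥ w)))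
    (hG : ∀ j (x : ι j → ℝ), x ⬝ᵥ ((flucCov (H j) (Qc j) - flucCov (effForm (H (j + 1)) (Qf j)) (Qc j)) *ᵥ x) ≤ CG * (x ⬝ᵥ x))
    (hS : ∀ j (y : c → ℝ), y ⬝ᵥ ((effForm (H (j + 1)) (Qc (j + 1)) - effForm (H j) (Qc j)) *ᵥ y) ≤ cS * θ ^ j * (y ⬝ᵥ y))
    (hF : ∀ j (e : c → ℝ), (((Q₁ j)ᵀ * effForm (H j) (Qc j) - H₁ j * minOp (H j) (Qc j)) *ᵥ e) ⬝ᵥ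
        (((Q₁ j)ᵀ * effForm (H j) (Qc j) - H₁ j * minOp (H j) (Qc j)) *ᵥ e) ≤ cF * θ ^ j * (e ⬝ᵥ e))
    (hU : ∀ j (e : c → ℝ), ((Q₁ j * minOp (H j) (Qc j)) *ᵥ e) ⬝ᵥ ((Q₁ j * minOp (H j) (Qc j)) *ᵥ e) ≤ cU * (e ⬝ᵥ e)) :
    ∀ j (e : c → ℝ), (dMinOp (H j) (Qc j) (H₁ j) (Q₁ j) *ᵥ e) ⬝ᵥ
        ((effForm (H (j + 1)) (Qf j) - H j) *ᵥ (dMinOp (H j) (Qc j) (H₁ j) (Q₁ j) *ᵥ e)) ≤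
      4 * (1 + cD) * (CG * cF + cS * cU) * θ ^ j * (e ⬝ᵥ e) := fun j e => by
  have hkΛ : IsUnit (kkt (effForm (H (j + 1)) (Qf j)) (Qc j)).det :=
    isUnit_det_kkt_oneStep _ _ _ (hkf j) (by rw [← hcomp j]; exact hk (j + 1))
  have hΛs : (effForm (H (j + 1)) (Qf j))ᵀ = effForm (H (j + 1)) (Qf j) :=
    (minOpL_eq_transpose (H (j + 1)) (Qf j) (transpose_eq_of_posSemidef (hH (j + 1)))).2.2
  have hD : (effForm (H (j + 1)) (Qf j) - H j).PosSemidef :=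
    oneStep_defect_posSemidef_of_stab (transpose_eq_of_posSemidef (hH j)) (hH (j + 1)) (hkf j) (hstab j)
  have tE : effForm (effForm (H (j + 1)) (Qf j)) (Qc j) = effForm (H (j + 1)) (Qc (j + 1)) := by
    rw [hcomp j]; exact effForm_oneStep_comp (H (j + 1)) (Qf j) (Qc j) (hkf j) hkΛ
  have hθj : 0 ≤ θ ^ j := pow_nonneg hθ j
  have key := jet_constrained_energy_H_le_of_rows (CS := cS * θ ^ j) (F := cF * θ ^ j * (e ⬝ᵥ e)) (U := cU * (e ⬝ᵥ e)) (hH j) hΛs hD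
    (hk j) hkΛ (H₁ j) (Q₁ j) e hcD hCG (mul_nonneg hcS hθj) (hker j) (hG j) (fun y => by rw [tE]; exact hS j y) (hF j e) (hU j e)
  calc _ ≤ 4 * (1 + cD) * (CG * (cF * θ ^ j * (e ⬝ᵥ e)) + cS * θ ^ j * (cU * (e ⬝ᵥ e))) := key
    _ = 4 * (1 + cD) * (CG * cF + cS * cU) * θ ^ j * (e ⬝ᵥ e) := by ring

end Tower

/-! ## §4 The jet direction of the true tower, NAMED (PART 14 BY NAME) -/

section Curve

variable {ν μ κ : Type*} [Fintype ν] [Fintype μ] [Fintype κ] [DecidableEq ν] [DecidableEq μ] [DecidableEq κ]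
variable {Hf : ℝ → Matrix ν ν ℝ} {q : ℝ → Matrix μ ν ℝ} {Qc : ℝ → Matrix κ μ ℝ}
variable {Hf' : Matrix ν ν ℝ} {q' : Matrix μ ν ℝ} {Qc' : Matrix κ μ ℝ} {s₀ : ℝ}

/-- **`hasDerivAt_decimated_minOp_curve` — `ℋ̃_{j,1} = dℋ(Λ_j, Qc_j; d𝒮(H_{j+1},Qf_j; H_{j+1,1}, Qf_{j,1}), Qc_{j,1})`** [our proof; PART 14 `hasDerivAt_effForm_curve` fed to
`hasDerivAt_minOp_curve`]: along any entrywise-differentiable curve of data `s ↦ (H₊(s), q(s), Q(s))` with nonsingular bordered matrices at `s₀`, the entries of the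
decimated minimiser `s ↦ ℋ(𝒮(H₊(s), q(s)), Q(s))` have derivatives the entries of `dℋ(𝒮(H₊,q), Q; d𝒮(H₊,q;H₊′,q′), Q′)` at `s₀` — the direction letters
`(Λ₁, Q₁)` of §3 for a true tower. -/
theorem hasDerivAt_decimated_minOp_curve (hH : ∀ i j, HasDerivAt (fun s => Hf s i j) (Hf' i j) s₀) (hq : ∀ i j, HasDerivAt (fun s => q s i j) (q' i j) s₀)
    (hQ : ∀ i j, HasDerivAt (fun s => Qc s i j) (Qc' i j) s₀) (hdet₁ : IsUnit (kkt (Hf s₀) (q s₀)).det)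
    (hdet₂ : IsUnit (kkt (effForm (Hf s₀) (q s₀)) (Qc s₀)).det) (i : μ) (j : κ) :
    HasDerivAt (fun s => minOp (effForm (Hf s) (q s)) (Qc s) i j)
      (dMinOp (effForm (Hf s₀) (q s₀)) (Qc s₀) (dEffForm (Hf s₀) (q s₀) Hf' q') Qc' i j) s₀ :=
  hasDerivAt_minOp_curve (H := fun s => effForm (Hf s) (q s)) (fun a b => hasDerivAt_effForm_curve hH hq hdet₁ a b) hQ hdet₂ i j

end Curve

end Summit.QuantumFields.BalabanUV.Beta.GAN24.DerivativeRateTransferKKTSourcesEnd
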